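import Summits.ValiantsHypothesis.ValiantsHypothesis.Theorems.BarrierLeverNaturalProofsSeparateVNPBorder
import Summits.ValiantsHypothesis.ValiantsHypothesis.Theorems.BarrierLeverNaturalProofsSeparateVNPDefFour
import Summits.ValiantsHypothesis.ValiantsHypothesis.Theorems.BarrierLeverSuccinctHittingSetsForVPLowDegreeEquations
import Summits.ValiantsHypothesis.ValiantsHypothesis.Theorems.BarrierLeverKRSTNoGoBelow6c

/-!
# Route BarrierLever — item `NaturalProofsSeparateVNP` (stmt-ValiantsHypothesis-18972): the
# NON-CONSTRUCTIVE skeleton of the item is a theorem (cell valiant-natproofs, seat val-np-p4 gen 5;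
# bears on ladder rung V4)

`S := Theses.BarrierLever.NaturalProofsSeparateVNP` reads
`∃ b₁ ∀ b n₀ ∃ n ≥ n₀ ∃ D, IsNaturalProof (degLEMonomials n) (SmallCircuits ℂ n b) (Distinguishers ℂ n 1) D
 ∧ ∃ g ∈ VNP_{n,b₁}, D(coeff g) ≠ 0` — usefulness against `VP_{n,b}` (vanishing), largeness
replaced by a `VNP`-succinct NON-ROOT, and CONSTRUCTIVITY `D ∈ Distinguishers ℂ n 1` (size and
degree `≤ N = C(2n,n)`), with ONE `b₁` for all `b`, infinitely often in `n`.

This file proves, UNCONDITIONALLY, what remains of `S` when constructivity is dropped or relaxed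
to quasi-polynomial, for EVERY `b` at ALL large `n` (with `b₁` depending on `b`):

* `Nonconstructive.exists_equation_nonRoot` — for every `b`, eventually in `n`, some NONZERO
  polynomial `D` in the `N` coefficient variables vanishes on `coeff(SmallCircuits ℂ n b)` and is
  nonzero at `coeff g` for some `g ∈ SmallCircuits ℂ n (b + 2)` (constant count, BCS 1997
  Thm. (9.13), tree `exists_equation_of_complexity_le`: size-`n^b` circuits carry `≤ 4n^b + 1`
  constants, so their coefficient vectors satisfy a nonzero relation on any `4n^b + 2` coordinates —
  here the multilinear coordinates `x^{bits(w)}`, `w < 4n^b + 2 ≤ 2^n` — and a relation in those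
  coordinates alone has a non-root among the `(4n^b + 2)`-sparse polynomials on them, which are
  small circuits of exponent `b + 2`).
* `Nonconstructive.exists_lt_approxComplexity` — **border hierarchy inside `VP`'s slices**: for
  every `b`, eventually in `n`, some `g` of degree `≤ n` with `L(g) ≤ n^(b+5)` has APPROXIMATE
  complexity `\underline{L}(g) > n^b` (BLMW 2011 Def. 9.3.1, tree `approxComplexity`; via
  `Border.lt_approxComplexity`, the truncation step costing the three exponents).
* `Nonconstructive.exists_quasipolynomial_equation_nonRoot` — for every `b` there is `c` with,
  eventually in `n`, an equation `D` for `SmallCircuits ℂ n b` of DEGREE `≤ n^c ≤ N` and SIZE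
  `≤ 2^(n^c)` (quasi-polynomial `N^{polylog N}`) with a non-root in `SmallCircuits ℂ n (c + 2)`
  (tree `LowDegreeEquations.exists_equation`, Raz's universal circuit + dimension count, with the
  tree's sparse hitting lemma `isSuccinctHittingSet_totalDegree_le_pow`).
* `Nonconstructive.matrix_univ` / `Nonconstructive.forall_exists_univ` — the item's matrix
  VERBATIM with `Distinguishers ℂ n 1` replaced by `Set.univ` (KRST 2022 Def. 4's notion of an
  equation) and `b₁ := b + 3`, for every `b` at all large `n`; hence the item's statement with its
  two leading quantifiers swapped (`∀ b ∃ b₁`) and constructivity dropped is a THEOREM.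
  `Nonconstructive.matrix_quasipolynomial` — the same with the distinguisher class
  `{D | deg D ≤ N ∧ L(D) ≤ 2^(n^c)}` in place of `Distinguishers ℂ n 1 = {D | L(D) ≤ N ∧ deg D ≤ N}`.

DICTIONARY (what is open in item 18972, made precise by these theorems): usefulness + a
`VNP ∩ VP`-succinct non-root are FREE for every single `b` (this file); the item adds exactly
(i) constructivity `N^{O(1)}` instead of `N^{polylog N}` — for `b ≤ 1` still free
(`LinearRange.naturalProofsSeparateVNP_range_le_one`), for `b = 2` already open as printed
(`N^{O(1)}`-size equations for circuits of size `Θ((log N)²)`; cf. FSV Question 6, CKRST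
Question 1.4, KRST 2022 §4) — and
(ii) ONE `b₁` for all `b`, which without constructivity is EXACTLY a pointwise-`VNP`-succinct family
outside `\overline{VP}` (sequel `…NaturalProofsSeparateVNPBorderFamily`, `univ_separate_iff_exists_family`),
i.e. the border form of Valiant's hypothesis in FSV's frame; with level-one constructivity it is
the item (`naturalProofsSeparateVNP_iff_exists_family`).

WHAT THIS IS NOT: not a proof or refutation of item 18972 (parked on crux 14610); no statement here
has constructivity `N^{O(1)}`; the non-roots are NON-explicit (a dimension count, no lower bound
for any explicit polynomial); nothing here is progress on `VP ≠ VNP`, on FSV Question 6 or on the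
hardness of the permanent. The counting facts are classical (Heintz–Schnorr 1980, BCS 1997 §9.1);
new is only their assembly in the item's exact frame.

References: [BurgisserClausenShokrollahi1997] §9.1, Thm. (9.13); [HeintzSchnorr1980];
[ForbesShpilkaVolk2018] Def. 1, §1.1, Question 6; [KumarRamyaSaptharishiTengse2022] Def. 4, §4;
[BurgisserEtAl2011] Def. 9.3.1; [Raz2010] Prop. 3.2–3.3.
-/

-- layout Summits/ValiantsHypothesis/ValiantsHypothesis forces the duplicated namespace component
set_option linter.dupNamespace false

noncomputable section

namespace Summit.ValiantsHypothesis.ValiantsHypothesis.Theorems.BarrierLever.NaturalProofsSeparateVNP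

open Literature.Barriers.ValiantsHypothesis Literature.Computability.AlgebraicComplexity MvPolynomial
open Summit.ValiantsHypothesis.ValiantsHypothesis.Theses
open Summit.ValiantsHypothesis.ValiantsHypothesis.Theorems.BarrierLever.SuccinctHittingSetsForVP

namespace Nonconstructive

/-! ### 1. Coordinates: the multilinear monomials `x^{bits(w)}`, `w < K ≤ 2^n` -/

/-- The binary-digit monomials `x^{bits(w)}` (`KRSTEdge.binMono`) are pairwise distinct for
`w < K ≤ 2^n` (`Σ_i bit_i(w) 2^i = w`). [folklore] -/
theorem binMono_injective {n K : ℕ} (hK : K ≤ 2 ^ n) :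
    Function.Injective fun w : Fin K => KRSTEdge.binMono n w := by
  intro w w' h
  have h' : KRSTEdge.binVec n w = KRSTEdge.binVec n w' := congrArg Subtype.val h
  have hw := KRSTEdge.sum_binVec_two_pow (lt_of_lt_of_le w.isLt hK)
  have hw' := KRSTEdge.sum_binVec_two_pow (lt_of_lt_of_le w'.isLt hK)
  rw [h'] at hw
  exact Fin.ext (hw.symm.trans hw')

/-- Budget of the sparse non-root: `(4 n^b + 2)(2n + 2) ≤ n^(b+2)` for `n ≥ 18`. [folklore] -/
theorem sparse_budget {n : ℕ} (b : ℕ) (hn : 18 ≤ n) : (4 * n ^ b + 2) * (2 * n + 2) ≤ n ^ (b + 2) := by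
  have h1 : 1 ≤ n ^ b := Nat.one_le_pow _ _ (by omega)
  calc (4 * n ^ b + 2) * (2 * n + 2) ≤ (6 * n ^ b) * (3 * n) :=
        Nat.mul_le_mul (by omega) (by omega)
    _ = 18 * (n ^ b * n) := by ring
    _ ≤ n * (n ^ b * n) := Nat.mul_le_mul_right _ hn
    _ = n ^ (b + 2) := by ring

/-! ### 2. A nonzero relation on `K` coordinates pulls back to an equation with a `K`-sparse
non-root -/

/-- **Pull-back with a sparse non-root.** Let `e : Fin K → degLEMonomials n` be injective and let
`D₀ ≠ 0` be a polynomial in `K` variables with `D₀(coeff_{e 0} f, …, coeff_{e (K-1)} f) = 0` for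
all `f` in a class `𝒞`. Then `D := D₀(c_{e 0}, …, c_{e (K-1)})` is a nonzero polynomial in the
coefficient variables vanishing on `coeff(𝒞)`, and it is nonzero at the coefficient vector of some
polynomial `Σ_{μ ∈ S} w_μ x^μ` supported on `S = range e` (over the infinite field `ℂ`, `D₀` has a
non-root `y`; take `w = y` transported along `e`). [folklore] -/
theorem exists_pullback_nonRoot {n K : ℕ} {e : Fin K → degLEMonomials n} (he : Function.Injective e)
    {𝒞 : Set (MvPolynomial (Fin n) ℂ)} {D₀ : MvPolynomial (Fin K) ℂ} (hD₀ : D₀ ≠ 0)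
    (hvan : ∀ f ∈ 𝒞, eval (fun i => coeff ((e i : degLEMonomials n) : Fin n →₀ ℕ) f) D₀ = 0) :
    ∃ D : MvPolynomial (degLEMonomials n) ℂ, D ≠ 0 ∧
      (∀ f ∈ 𝒞, eval (coeffVector (degLEMonomials n) f) D = 0) ∧
      ∃ w : degLEMonomials n → ℂ, (∀ μ, μ ∉ (Finset.univ.image e) → w μ = 0) ∧
        eval (coeffVector (degLEMonomials n)
          (∑ μ ∈ Finset.univ.image e, (monomial (μ : Fin n →₀ ℕ) (w μ) : MvPolynomial (Fin n) ℂ))) D ≠ 0 := by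
  classical
  -- a non-root of `D₀` over the infinite field `ℂ`
  obtain ⟨y, hy⟩ : ∃ y : Fin K → ℂ, eval y D₀ ≠ 0 := by
    by_contra h
    push Not at h
    exact hD₀ (MvPolynomial.funext fun y => by rw [h y, map_zero])
  have hext0 : ∀ μ, μ ∉ Finset.univ.image e → Function.extend e y 0 μ = 0 := by
    intro μ hμ
    have hμ' : ¬ ∃ i, e i = μ := by
      rintro ⟨i, rfl⟩
      exact hμ (Finset.mem_image.mpr ⟨i, Finset.mem_univ _, rfl⟩)
    rw [Function.extend_apply' _ _ _ hμ', Pi.zero_apply]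
  refine ⟨rename e D₀, ?_, fun f hf => ?_, Function.extend e y 0, hext0, ?_⟩
  · intro h0
    exact hD₀ (rename_injective e he (by rw [h0, map_zero]))
  · rw [eval_rename]
    exact hvan f hf
  · rw [LowDegree.coeffVector_sparse _ hext0, eval_rename]
    have hcomp : (Function.extend e y 0 ∘ e) = y := funext fun i => he.extend_apply y 0 i
    rwa [hcomp]

/-! ### 3. Equations for `VP_{n,b}` with a non-root in `VP_{n,b+2}`, unconditionally -/

/-- **For every `b`, eventually in `n`: a nonzero equation of `coeff(SmallCircuits ℂ n b)` (no
degree or size bound claimed) with a NON-ROOT in `SmallCircuits ℂ n (b + 2)`.** Constant count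
(BCS Thm. (9.13), tree `exists_equation_of_complexity_le` at `s = n^b` on the `K = 4n^b + 2`
multilinear coordinates `x^{bits(w)}`, `w < K ≤ n^(b+1) ≤ 2^n`, `KRSTEdge.four_mul_pow_add_two_le`)
and `exists_pullback_nonRoot`; the
`K`-sparse non-root has `L ≤ K(2n + 2) ≤ n^(b+2)` (`LowDegree.sparse_mem_smallCircuits`, `n ≥ 18`).
[cite: BurgisserClausenShokrollahi1997, §9.1 and Thm. (9.13)] [cite: ForbesShpilkaVolk2018, Def. 1] -/
theorem exists_equation_nonRoot (b : ℕ) : ∃ n₀ : ℕ, ∀ n : ℕ, n₀ ≤ n →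
    ∃ D : MvPolynomial (degLEMonomials n) ℂ, D ≠ 0 ∧
      (∀ f ∈ SmallCircuits ℂ n b, eval (coeffVector (degLEMonomials n) f) D = 0) ∧
      ∃ g ∈ SmallCircuits ℂ n (b + 2), eval (coeffVector (degLEMonomials n) g) D ≠ 0 := by
  classical
  obtain ⟨n₁, hn₁⟩ := LowDegreeEquations.eventually_mul_pow_le_two_pow 1 (b + 1)
  refine ⟨max n₁ 18, fun n hn => ?_⟩
  have hn18 : 18 ≤ n := (le_max_right _ _).trans hn
  set K := 4 * n ^ b + 2 with hK
  have hK2 : K ≤ 2 ^ n := by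
    have h1 := hn₁ n ((le_max_left _ _).trans hn)
    rw [one_mul] at h1
    exact (KRSTEdge.four_mul_pow_add_two_le b (by omega)).trans h1
  have he := binMono_injective (n := n) hK2
  obtain ⟨D₀, hD₀, hvan₀⟩ := exists_equation_of_complexity_le (F := ℂ) (σ := Fin n) (n ^ b)
    (K := K) (by omega) (fun w : Fin K => ((KRSTEdge.binMono n w : degLEMonomials n) : Fin n →₀ ℕ))
  obtain ⟨D, hD, hvan, w, hw, hne⟩ := exists_pullback_nonRoot (𝒞 := SmallCircuits ℂ n b) he hD₀
    (fun f hf => hvan₀ f hf.2)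
  refine ⟨D, hD, hvan, _, LowDegree.sparse_mem_smallCircuits _ w ?_, hne⟩
  rw [Finset.card_image_of_injective _ he, Finset.card_univ, Fintype.card_fin]
  exact sparse_budget b hn18

/-- The same in FSV's vocabulary: an algebraically natural proof against `SmallCircuits ℂ n b` of
UNRESTRICTED constructivity (`𝒟 = Set.univ`, i.e. an equation in the sense of KRST 2022 Def. 4)
with a non-root in `SmallCircuits ℂ n (b + 2)`, for every `b` at all large `n`.
[cite: ForbesShpilkaVolk2018, Def. 1] [cite: KumarRamyaSaptharishiTengse2022, Def. 4] -/
theorem exists_isNaturalProof_univ_nonRoot (b : ℕ) : ∃ n₀ : ℕ, ∀ n : ℕ, n₀ ≤ n →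
    ∃ D : MvPolynomial (degLEMonomials n) ℂ,
      IsNaturalProof (degLEMonomials n) (SmallCircuits ℂ n b) Set.univ D ∧
      ∃ g ∈ SmallCircuits ℂ n (b + 2), eval (coeffVector (degLEMonomials n) g) D ≠ 0 := by
  obtain ⟨n₀, h⟩ := exists_equation_nonRoot b
  refine ⟨n₀, fun n hn => ?_⟩
  obtain ⟨D, hD, hvan, g, hg, hne⟩ := h n hn
  exact ⟨D, ⟨Set.mem_univ _, hD, hvan⟩, g, hg, hne⟩

/-- Equivalently: for every `b`, eventually, `coeff(SmallCircuits ℂ n (b + 2))` is NOT contained in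
the Zariski closure of `coeff(SmallCircuits ℂ n b)` inside the `N`-dimensional coefficient space of
degree-`≤ n` polynomials (tree `zariskiClosure`). [cite: BurgisserClausenShokrollahi1997, Thm. (9.13)] -/
theorem exists_coeffVector_not_mem_zariskiClosure (b : ℕ) : ∃ n₀ : ℕ, ∀ n : ℕ, n₀ ≤ n →
    ∃ g ∈ SmallCircuits ℂ n (b + 2), coeffVector (degLEMonomials n) g ∉
      zariskiClosure (coeffVector (degLEMonomials n) '' SmallCircuits ℂ n b) := by
  obtain ⟨n₀, h⟩ := exists_equation_nonRoot b
  refine ⟨n₀, fun n hn => ?_⟩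
  obtain ⟨D, -, hvan, g, hg, hne⟩ := h n hn
  refine ⟨g, hg, fun hmem => hne ?_⟩
  rw [mem_zariskiClosure_iff] at hmem
  have key : aeval (coeffVector (degLEMonomials n) g) D = 0 :=
    hmem D (by rintro _ ⟨f, hf, rfl⟩; exact hvan f hf)
  exact key

/-! ### 4. Border hierarchy inside `VP`'s slices -/

/-- **For every `b`, eventually in `n`, some `g ∈ SmallCircuits ℂ n (b + 5)` has approximate
(border) complexity `\underline{L}(g) > n^b`** (BLMW 2011 Def. 9.3.1: `coeff g` is outside the
Zariski closure of the coefficient vectors of ALL polynomials of circuit size `≤ n^b`, any degree).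
From `exists_equation_nonRoot (b + 3)` and `Border.lt_approxComplexity` (truncating a size-`n^b`
approximant to degree `≤ n` costs `(n+2)² n^b + (n+1) ≤ n^(b+3)`, `Border.truncation_budget`).
[cite: BurgisserEtAl2011, Def. 9.3.1] [cite: BurgisserClausenShokrollahi1997, Thm. (9.13)] -/
theorem exists_lt_approxComplexity (b : ℕ) : ∃ n₀ : ℕ, ∀ n : ℕ, n₀ ≤ n →
    ∃ g ∈ SmallCircuits ℂ n (b + 5), n ^ b < approxComplexity g := by
  obtain ⟨n₀, h⟩ := exists_equation_nonRoot (b + 3)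
  obtain ⟨n₁, hn₁⟩ := Border.truncation_budget 1 b
  refine ⟨max n₀ n₁, fun n hn => ?_⟩
  obtain ⟨D, -, hvan, g, hg, hne⟩ := h n ((le_max_left _ _).trans hn)
  refine ⟨g, hg, Border.lt_approxComplexity hvan hne ?_⟩
  have h1 := hn₁ n ((le_max_right _ _).trans hn)
  have h2 : n ^ b ≤ 1 * (n + 1) ^ b := by
    rw [one_mul]; exact Nat.pow_le_pow_left (Nat.le_succ n) b
  exact le_trans (by gcongr) h1

/-- Family form: no single exponent bounds the approximate complexity of all small circuits two...five
exponents up — for every `b` the slice `SmallCircuits ℂ n (b + 5)` eventually leaves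
`{g | \underline{L}(g) ≤ n^b}`. (A hierarchy for `\underline{L}` by counting; no explicit `g`.)
[cite: BurgisserEtAl2011, §9.3] -/
theorem not_approxComplexity_le_pow (b : ℕ) : ¬ ∃ n₀ : ℕ, ∀ n : ℕ, n₀ ≤ n →
    ∀ g ∈ SmallCircuits ℂ n (b + 5), approxComplexity g ≤ n ^ b := by
  rintro ⟨n₀, h⟩
  obtain ⟨n₁, hn₁⟩ := exists_lt_approxComplexity b
  obtain ⟨g, hg, hlt⟩ := hn₁ (max n₀ n₁) (le_max_right _ _)
  exact absurd (h (max n₀ n₁) (le_max_left _ _) g hg) (not_le.mpr hlt)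

/-! ### 5. Quasi-polynomial constructivity is free -/

/-- **For every `b` there is `c` with, eventually in `n`: an equation of `coeff(SmallCircuits ℂ n b)`
of total degree `≤ n^c` and fan-in-two size `≤ 2^(n^c)` — quasi-polynomial `N^{polylog N}` in
`N = C(2n,n) ≥ 2^n` — with a NON-ROOT in `SmallCircuits ℂ n (c + 2)`.** The equation is the tree's
`LowDegreeEquations.exists_equation` (Raz's universal circuit + dimension count); a nonzero
polynomial of degree `≤ n^c` is hit by the `n^c`-sparse degree-`≤ n` polynomials
(`isSuccinctHittingSet_totalDegree_le_pow`). [cite: ForbesShpilkaVolk2018, Def. 1 and §1.1] [cite: Raz2010, Prop. 3.2–3.3] -/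
theorem exists_quasipolynomial_equation_nonRoot (b : ℕ) : ∃ c n₀ : ℕ, ∀ n : ℕ, n₀ ≤ n →
    ∃ D : MvPolynomial (degLEMonomials n) ℂ, D ≠ 0 ∧ D.totalDegree ≤ n ^ c ∧
      complexity D ≤ 2 ^ (n ^ c) ∧
      (∀ f ∈ SmallCircuits ℂ n b, eval (coeffVector (degLEMonomials n) f) D = 0) ∧
      ∃ g ∈ SmallCircuits ℂ n (c + 2), eval (coeffVector (degLEMonomials n) g) D ≠ 0 := by
  obtain ⟨c, n₀, h⟩ := LowDegreeEquations.exists_equation b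
  refine ⟨c, max n₀ 3, fun n hn => ?_⟩
  obtain ⟨D, hD, hdeg, hsize, hvan⟩ := h n ((le_max_left _ _).trans hn)
  obtain ⟨g, hg, hne⟩ :=
    isSuccinctHittingSet_totalDegree_le_pow c ((le_max_right _ _).trans hn) D hdeg hD
  exact ⟨D, hD, hdeg, hsize, hvan, g, hg, hne⟩

/-! ### 6. The item's matrix with constructivity dropped / relaxed -/

/-- **Item 18972's matrix with `Distinguishers ℂ n 1` replaced by `Set.univ`, for EVERY `b` at ALL
large `n`, with `b₁ := b + 3`** (the non-root of `exists_isNaturalProof_univ_nonRoot` lies in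
`SmallCircuits ℂ n (b+2) ⊆ SmallDefinable ℂ n (b+3)`, `smallCircuits_subset_smallDefinable_succ`; the
set-builder is the item's inlined `SmallDefinable` body, character for character).
[cite: ForbesShpilkaVolk2018, Def. 1] [cite: KumarRamyaSaptharishiTengse2022, Def. 3–4] -/
theorem matrix_univ (b : ℕ) : ∃ n₀ : ℕ, ∀ n : ℕ, n₀ ≤ n →
    ∃ D : MvPolynomial (degLEMonomials n) ℂ,
      IsNaturalProof (degLEMonomials n) (SmallCircuits ℂ n b) Set.univ D ∧
      ∃ g ∈ {f : MvPolynomial (Fin n) ℂ | f.totalDegree ≤ n ∧ ∃ u : ℕ, u ≤ n ^ (b + 3) ∧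
          ∃ g : MvPolynomial (Fin n ⊕ Fin u) ℂ, complexity g ≤ n ^ (b + 3) ∧
            g.totalDegree ≤ n ^ (b + 3) ∧ f = boolSum g},
        eval (coeffVector (degLEMonomials n) g) D ≠ 0 := by
  obtain ⟨n₀, h⟩ := exists_isNaturalProof_univ_nonRoot b
  refine ⟨max n₀ 1, fun n hn => ?_⟩
  obtain ⟨D, hD, g, hg, hne⟩ := h n ((le_max_left _ _).trans hn)
  exact ⟨D, hD, g, smallCircuits_subset_smallDefinable_succ ((le_max_right _ _).trans hn) hg, hne⟩

/-- **The item with its two leading quantifiers swapped and constructivity dropped is a theorem:**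
`∀ b ∃ b₁ ∀ n₀ ∃ n ≥ n₀ ∃ D, IsNaturalProof (degLEMonomials n) (SmallCircuits ℂ n b) Set.univ D ∧
∃ g ∈ VNP_{n,b₁}, D(coeff g) ≠ 0` (compare `Theses.BarrierLever.NaturalProofsSeparateVNP`:
`∃ b₁ ∀ b n₀ ∃ n ≥ n₀ ∃ D, IsNaturalProof … (Distinguishers ℂ n 1) D ∧ …`). What the open item adds is
therefore exactly: constructivity `N^{O(1)}` and ONE `b₁` for all `b`.
[cite: ForbesShpilkaVolk2018, Def. 1 and Question 6] -/
theorem forall_exists_univ : ∀ b : ℕ, ∃ b₁ : ℕ, ∀ n₀ : ℕ, ∃ n : ℕ, n₀ ≤ n ∧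
    ∃ D : MvPolynomial (degLEMonomials n) ℂ,
      IsNaturalProof (degLEMonomials n) (SmallCircuits ℂ n b) Set.univ D ∧
      ∃ g ∈ {f : MvPolynomial (Fin n) ℂ | f.totalDegree ≤ n ∧ ∃ u : ℕ, u ≤ n ^ b₁ ∧
          ∃ g : MvPolynomial (Fin n ⊕ Fin u) ℂ, complexity g ≤ n ^ b₁ ∧
            g.totalDegree ≤ n ^ b₁ ∧ f = boolSum g},
        eval (coeffVector (degLEMonomials n) g) D ≠ 0 := by
  intro b
  obtain ⟨n₁, h⟩ := matrix_univ b
  refine ⟨b + 3, fun n₀ => ⟨max n₀ n₁, le_max_left _ _, ?_⟩⟩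
  exact h (max n₀ n₁) (le_max_right _ _)

/-- **Item 18972's matrix at QUASI-POLYNOMIAL constructivity, for every `b` at all large `n`:** the
distinguisher class `{D | deg D ≤ N ∧ L(D) ≤ 2^(n^c)}` (`N = C(2n,n)`; compare the item's
`Distinguishers ℂ n 1 = {D | L(D) ≤ N ∧ deg D ≤ N}`) admits, eventually, a natural proof against
`SmallCircuits ℂ n b` with a non-root in `VNP_{n,b₁}`, `b₁ = c + 3`. So the constructivity gap of
the open item is `N^{polylog N}` (free) versus `N^{O(1)}` (FSV Question 6 / CKRST Question 1.4).
[cite: ForbesShpilkaVolk2018, Def. 1, Question 6] [cite: ChatterjeeKumarRamyaSaptharishiTengse2020, §1.4] -/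
theorem matrix_quasipolynomial (b : ℕ) : ∃ c b₁ n₀ : ℕ, ∀ n : ℕ, n₀ ≤ n →
    ∃ D : MvPolynomial (degLEMonomials n) ℂ,
      IsNaturalProof (degLEMonomials n) (SmallCircuits ℂ n b)
        {D | D.totalDegree ≤ Nat.choose (2 * n) n ∧ complexity D ≤ 2 ^ (n ^ c)} D ∧
      ∃ g ∈ {f : MvPolynomial (Fin n) ℂ | f.totalDegree ≤ n ∧ ∃ u : ℕ, u ≤ n ^ b₁ ∧
          ∃ g : MvPolynomial (Fin n ⊕ Fin u) ℂ, complexity g ≤ n ^ b₁ ∧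
            g.totalDegree ≤ n ^ b₁ ∧ f = boolSum g},
        eval (coeffVector (degLEMonomials n) g) D ≠ 0 := by
  obtain ⟨c, n₀, h⟩ := exists_quasipolynomial_equation_nonRoot b
  obtain ⟨n₁, hn₁⟩ := LowDegreeEquations.eventually_mul_pow_le_two_pow 1 c
  refine ⟨c, c + 3, max (max n₀ n₁) 4, fun n hn => ?_⟩
  have hn₀ : n₀ ≤ n := le_trans (le_max_left _ _) ((le_max_left _ _).trans hn)
  have hn₁' : n₁ ≤ n := le_trans (le_max_right _ _) ((le_max_left _ _).trans hn)
  have hn4 : 4 ≤ n := (le_max_right _ _).trans hn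
  obtain ⟨D, hD, hdeg, hsize, hvan, g, hg, hne⟩ := h n hn₀
  have hN : n ^ c ≤ Nat.choose (2 * n) n := by
    have h1 := hn₁ n hn₁'
    rw [one_mul] at h1
    exact h1.trans (LowDegreeEquations.two_pow_le_choose hn4)
  exact ⟨D, ⟨⟨hdeg.trans hN, hsize⟩, hD, hvan⟩, g,
    smallCircuits_subset_smallDefinable_succ (le_trans (by norm_num) hn4) hg, hne⟩

/-- For comparison, the item itself in the same shape (definitional unfolding, no content): `S` is
`∃ b₁ ∀ b n₀ ∃ n ≥ n₀` of the matrix with the distinguisher class `Distinguishers ℂ n 1`.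
[cite: ForbesShpilkaVolk2018, Def. 1 and Question 6] -/
theorem naturalProofsSeparateVNP_iff_matrix :
    BarrierLever.NaturalProofsSeparateVNP ↔ ∃ b₁ : ℕ, ∀ b n₀ : ℕ, ∃ n : ℕ, n₀ ≤ n ∧
      ∃ D : MvPolynomial (degLEMonomials n) ℂ,
        IsNaturalProof (degLEMonomials n) (SmallCircuits ℂ n b) (Distinguishers ℂ n 1) D ∧
        ∃ g ∈ {f : MvPolynomial (Fin n) ℂ | f.totalDegree ≤ n ∧ ∃ u : ℕ, u ≤ n ^ b₁ ∧
            ∃ g : MvPolynomial (Fin n ⊕ Fin u) ℂ, complexity g ≤ n ^ b₁ ∧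
              g.totalDegree ≤ n ^ b₁ ∧ f = boolSum g},
          eval (coeffVector (degLEMonomials n) g) D ≠ 0 :=
  Iff.rfl

end Nonconstructive

end Summit.ValiantsHypothesis.ValiantsHypothesis.Theorems.BarrierLever.NaturalProofsSeparateVNP

end
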